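import Literature.ModelTheory.ExponentialFields.SemialgebraicClusterSets
import Literature.NumberTheory.Transcendental.SemialgebraicMonotonicityDefinable
import Literature.NumberTheory.Transcendental.SemialgebraicDerivativeProofs
import HarnessLib

/-!
# Partial derivatives of semialgebraic functions are semialgebraic (real coefficients, open sets)

Topic `Literature/ModelTheory/ExponentialFields` — block B4₁ of the proof of the
`C¹`-triangulation theorem for compact semialgebraic sets
(`Literature.ModelTheory.ExponentialFields.OhmotoShiota2017_c1Triangulation`, statement of
[OhmotoShiota2017, Thm. 1.1]) along the proof of [Pawlucki2024], specialized to `p = 1`.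

[BochnakCosteRoy1998, Prop. 2.9.1 (iii)] / [BasuPollackRoy2006, §3.5]: the partial derivatives of
a semialgebraic function differentiable on an open semialgebraic set are semialgebraic — the
graph of `∂f/∂xᵢ` is described by the first-order `ε`–`δ` formula for the limit of difference
quotients, and quantifiers are eliminated by Tarski–Seidenberg.  (The tree's
`IsSemialgebraicFunOn.hasDerivAt_last_isSemialgebraic_holds` is the `ℚ`-coefficient, fibrewise
version for the last coordinate; here we need real coefficients and every coordinate.)

No named facts are introduced (D-0026).

## References

* [BochnakCosteRoy1998] J. Bochnak, M. Coste, M.-F. Roy, *Real Algebraic Geometry*, Prop. 2.9.1,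
  Thm. 2.2.1, Prop. 2.2.4.
* [Pawlucki2024] W. Pawłucki, *Strict `C^p`-triangulations …*, J. Eur. Math. Soc. 26 (2024), §5.3.
-/

noncomputable section

open Set Filter Metric
open _root_.Topology

namespace Literature.ModelTheory.ExponentialFields

open Literature.NumberTheory.Transcendental (IsSemialgebraicFunOn IsSemialgebraicMapOn
  isSemialgebraicFunOn_iff)
open Literature.NumberTheory.Transcendental.SemialgebraicMonotonicity (sa_and sa_or sa_not sa_imp
  sa_lt sa_le sa_eq sa_const_lt sa_lt_const sa_exists_snoc sa_forall_snoc)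

section PartialDeriv

variable {n : ℕ}

/-- The `i`-th partial derivative `∂f/∂xᵢ (z) = Df(z) eᵢ`. [cite: BochnakCosteRoy1998, Prop. 2.9.1] -/
def partialDeriv (f : (Fin n → ℝ) → ℝ) (i : Fin n) (z : Fin n → ℝ) : ℝ := fderiv ℝ f z (Pi.single i 1)

/-- The slice `s ↦ f (update z i s)` has derivative `∂ᵢ f z` at `z i`.
[cite: BochnakCosteRoy1998, Prop. 2.9.1] -/
theorem hasDerivAt_slice {f : (Fin n → ℝ) → ℝ} {z : Fin n → ℝ} (hf : DifferentiableAt ℝ f z) (i : Fin n) :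
    HasDerivAt (fun s => f (Function.update z i s)) (partialDeriv f i z) (z i) := by
  have h1 : HasDerivAt (Function.update z i) (Pi.single i 1) (z i) := hasDerivAt_update z i (z i)
  have h2 : HasFDerivAt f (fderiv ℝ f z) (Function.update z i (z i)) := by
    rw [Function.update_eq_self]; exact hf.hasFDerivAt
  exact h2.comp_hasDerivAt (z i) h1

/-- The `ε`–`δ` clause for the partial derivative on an open set. [cite: BochnakCosteRoy1998, Prop. 2.9.1] -/
theorem partialDeriv_eq_iff {U : Set (Fin n → ℝ)} (hU : IsOpen U) {f : (Fin n → ℝ) → ℝ}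
    (hd : DifferentiableOn ℝ f U) {z : Fin n → ℝ} (hz : z ∈ U) (i : Fin n) (y : ℝ) :
    y = partialDeriv f i z ↔ ∀ ε : ℝ, 0 < ε → ∃ δ : ℝ, 0 < δ ∧ ∀ s : ℝ, Function.update z i s ∈ U → s ≠ z i →
      (s - z i) ^ 2 < δ ^ 2 → (f (Function.update z i s) - f z - y * (s - z i)) ^ 2 < ε ^ 2 * (s - z i) ^ 2 := by
  have hI : {s : ℝ | Function.update z i s ∈ U} ∈ 𝓝 (z i) := by
    have hc : Continuous fun s : ℝ => Function.update z i s := continuous_const.update i continuous_id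
    exact hc.continuousAt.preimage_mem_nhds (by rw [Function.update_eq_self]; exact hU.mem_nhds hz)
  have hder := hasDerivAt_slice (hd z hz |>.differentiableAt (hU.mem_nhds hz)) i
  have hfz : f (Function.update z i (z i)) = f z := by rw [Function.update_eq_self]
  constructor
  · rintro rfl
    intro ε hε
    obtain ⟨δ, hδ, h⟩ := (Literature.NumberTheory.Transcendental.SemialgebraicDerivative.hasDerivAt_iff_forall_mem hI).1 hder ε hε
    refine ⟨δ, hδ, fun s hs hne hsδ => ?_⟩
    have h' := h s hs hne hsδ
    rwa [hfz] at h'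
  · intro H
    refine (HasDerivAt.unique ?_ hder)
    refine (Literature.NumberTheory.Transcendental.SemialgebraicDerivative.hasDerivAt_iff_forall_mem hI).2 fun ε hε => ?_
    obtain ⟨δ, hδ, h⟩ := H ε hε
    refine ⟨δ, hδ, fun s hs hne hsδ => ?_⟩
    rw [hfz]; exact h s hs hne hsδ

/-! #### The first-order formula

Matrix vector `W = (z, y, ε, δ, s, u, v) ∈ ℝⁿ⁺⁶`, coordinates presented through iterated
`Fin.castSucc` / `Fin.last` so that `Fin.snoc` evaluates by `simp`. -/

section Idx

variable (n)

/-- coordinate `v`. [folklore] -/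
abbrev ixV : Fin (n + 6) := Fin.last (n + 5)
/-- coordinate `u`. [folklore] -/
abbrev ixU : Fin (n + 6) := (Fin.last (n + 4)).castSucc
/-- coordinate `s`. [folklore] -/
abbrev ixS : Fin (n + 6) := (Fin.last (n + 3)).castSucc.castSucc
/-- coordinate `δ`. [folklore] -/
abbrev ixD : Fin (n + 6) := (Fin.last (n + 2)).castSucc.castSucc.castSucc
/-- coordinate `ε`. [folklore] -/
abbrev ixE : Fin (n + 6) := (Fin.last (n + 1)).castSucc.castSucc.castSucc.castSucc
/-- coordinate `y`. [folklore] -/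
abbrev ixY : Fin (n + 6) := (Fin.last n).castSucc.castSucc.castSucc.castSucc.castSucc
/-- base coordinates `z`. [folklore] -/
abbrev ixZ (l : Fin n) : Fin (n + 6) := l.castSucc.castSucc.castSucc.castSucc.castSucc.castSucc

end Idx

/-- The updated point `update z i s` as a reindexing of `W`. [folklore] -/
def ixUpd (n : ℕ) (i : Fin n) (l : Fin n) : Fin (n + 6) := if l = i then ixS n else ixZ n l

/-- The matrix vector built from `w = (z, y)` and `ε, δ, s, u, v`. [folklore] -/
def pdW (w : Fin (n + 1) → ℝ) (ε δ s u v : ℝ) : Fin (n + 6) → ℝ :=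
  Fin.snoc (Fin.snoc (Fin.snoc (Fin.snoc (Fin.snoc w ε : Fin (n + 2) → ℝ) δ : Fin (n + 3) → ℝ) s :
    Fin (n + 4) → ℝ) u : Fin (n + 5) → ℝ) v

/-- `W` at coordinate `v`. [folklore] -/
@[simp] theorem pdW_V (w : Fin (n + 1) → ℝ) (ε δ s u v : ℝ) : pdW w ε δ s u v (ixV n) = v := by simp [pdW, ixV]
/-- `W` at coordinate `u`. [folklore] -/
@[simp] theorem pdW_U (w : Fin (n + 1) → ℝ) (ε δ s u v : ℝ) : pdW w ε δ s u v (ixU n) = u := by simp [pdW, ixU]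
/-- `W` at coordinate `s`. [folklore] -/
@[simp] theorem pdW_S (w : Fin (n + 1) → ℝ) (ε δ s u v : ℝ) : pdW w ε δ s u v (ixS n) = s := by simp [pdW, ixS]
/-- `W` at coordinate `δ`. [folklore] -/
@[simp] theorem pdW_D (w : Fin (n + 1) → ℝ) (ε δ s u v : ℝ) : pdW w ε δ s u v (ixD n) = δ := by simp [pdW, ixD]
/-- `W` at coordinate `ε`. [folklore] -/
@[simp] theorem pdW_E (w : Fin (n + 1) → ℝ) (ε δ s u v : ℝ) : pdW w ε δ s u v (ixE n) = ε := by simp [pdW, ixE]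
/-- `W` at coordinate `y`. [folklore] -/
@[simp] theorem pdW_Y (w : Fin (n + 1) → ℝ) (ε δ s u v : ℝ) : pdW w ε δ s u v (ixY n) = w (Fin.last n) := by
  simp [pdW, ixY]
/-- `W` at the base coordinates. [folklore] -/
@[simp] theorem pdW_Z (w : Fin (n + 1) → ℝ) (ε δ s u v : ℝ) (l : Fin n) :
    pdW w ε δ s u v (ixZ n l) = w l.castSucc := by simp [pdW, ixZ]

/-- `W ∘ ixZ = init w`. [folklore] -/
theorem pdW_comp_ixZ (w : Fin (n + 1) → ℝ) (ε δ s u v : ℝ) : pdW w ε δ s u v ∘ ixZ n = Fin.init w := by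
  funext l; simp [Fin.init]

/-- `W ∘ ixUpd = update (init w) i s`. [folklore] -/
theorem pdW_comp_ixUpd (w : Fin (n + 1) → ℝ) (ε δ s u v : ℝ) (i : Fin n) :
    pdW w ε δ s u v ∘ ixUpd n i = Function.update (Fin.init w) i s := by
  funext l
  by_cases h : l = i
  · subst h; simp [ixUpd]
  · simp [ixUpd, h, Fin.init]

/-- Transport of semialgebraicity along a set equality. [folklore] -/
theorem IsSemialgebraic.congr_set {k : ℕ} {A B : Set (Fin k → ℝ)} (h : IsSemialgebraic ℝ A) (hAB : A = B) :
    IsSemialgebraic ℝ B := hAB ▸ h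

/-- **Partial derivatives of semialgebraic functions are semialgebraic.**
[cite: BochnakCosteRoy1998, Prop. 2.9.1 (iii)] -/
theorem isSemialgebraicFunOn_partialDeriv {U : Set (Fin n → ℝ)} (hU : IsOpen U) (hUs : IsSemialgebraic ℝ U)
    {f : (Fin n → ℝ) → ℝ} (hf : IsSemialgebraicFunOn ℝ U f) (hd : DifferentiableOn ℝ f U) (i : Fin n) :
    IsSemialgebraicFunOn ℝ U (partialDeriv f i) := by
  have hΓ : IsSemialgebraic ℝ {w : Fin (n + 1) → ℝ | Fin.init w ∈ U ∧ w (Fin.last n) = f (Fin.init w)} :=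
    isSemialgebraicFunOn_iff.mp hf
  -- the matrix
  set M : Set (Fin (n + 6) → ℝ) := {W |
    (W ∘ ixUpd n i ∈ U ∧ W (ixU n) = f (W ∘ ixUpd n i)) → (W ∘ ixZ n ∈ U ∧ W (ixV n) = f (W ∘ ixZ n)) →
      ¬ W (ixS n) = W (ixZ n i) → (W (ixS n) - W (ixZ n i)) ^ 2 < W (ixD n) ^ 2 →
      (W (ixU n) - W (ixV n) - W (ixY n) * (W (ixS n) - W (ixZ n i))) ^ 2 <
        W (ixE n) ^ 2 * (W (ixS n) - W (ixZ n i)) ^ 2} with hM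
  have hMsa : IsSemialgebraic ℝ M := by
    refine sa_imp ?_ (sa_imp ?_ (sa_imp (sa_not (sa_eq _ _)) (sa_imp ?_ ?_)))
    · have h := hΓ.preimage_comp (Fin.snoc (ixUpd n i) (ixU n))
      convert h using 1; ext W; simp [Fin.comp_snoc]
    · have h := hΓ.preimage_comp (Fin.snoc (ixZ n) (ixV n))
      convert h using 1; ext W; simp [Fin.comp_snoc]
    · have h := isSemialgebraic_setOf_eval_lt (k := ℝ) (R := ℝ)
        ((MvPolynomial.X (ixS n) - MvPolynomial.X (ixZ n i)) ^ 2 : MvPolynomial (Fin (n + 6)) ℝ)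
        (MvPolynomial.X (ixD n) ^ 2)
      refine IsSemialgebraic.congr_set h ?_
      ext W; simp
    · have h := isSemialgebraic_setOf_eval_lt (k := ℝ) (R := ℝ)
        ((MvPolynomial.X (ixU n) - MvPolynomial.X (ixV n) -
          MvPolynomial.X (ixY n) * (MvPolynomial.X (ixS n) - MvPolynomial.X (ixZ n i))) ^ 2 :
          MvPolynomial (Fin (n + 6)) ℝ)
        (MvPolynomial.X (ixE n) ^ 2 * (MvPolynomial.X (ixS n) - MvPolynomial.X (ixZ n i)) ^ 2)
      refine IsSemialgebraic.congr_set h ?_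
      ext W; simp
  -- quantifier elimination, bottom-up: `∀ v`, `∀ u`, `∀ s`, `∃ δ > 0`, `∀ ε > 0`
  have h5 : IsSemialgebraic ℝ {W : Fin (n + 5) → ℝ | ∀ v : ℝ, (Fin.snoc W v : Fin (n + 6) → ℝ) ∈ M} :=
    sa_forall_snoc (n := n + 5) hMsa
  have h4 : IsSemialgebraic ℝ {W : Fin (n + 4) → ℝ | ∀ u v : ℝ,
      (Fin.snoc (Fin.snoc W u : Fin (n + 5) → ℝ) v : Fin (n + 6) → ℝ) ∈ M} :=
    sa_forall_snoc (n := n + 4) h5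
  have h3 : IsSemialgebraic ℝ {W : Fin (n + 3) → ℝ | ∀ s u v : ℝ,
      (Fin.snoc (Fin.snoc (Fin.snoc W s : Fin (n + 4) → ℝ) u : Fin (n + 5) → ℝ) v : Fin (n + 6) → ℝ) ∈ M} :=
    sa_forall_snoc (n := n + 3) h4
  have h3' : IsSemialgebraic ℝ {W : Fin (n + 3) → ℝ | 0 < W (Fin.last (n + 2)) ∧ ∀ s u v : ℝ,
      (Fin.snoc (Fin.snoc (Fin.snoc W s : Fin (n + 4) → ℝ) u : Fin (n + 5) → ℝ) v : Fin (n + 6) → ℝ) ∈ M} :=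
    (sa_const_lt _ _).inter h3
  have h2 : IsSemialgebraic ℝ {W : Fin (n + 2) → ℝ | ∃ δ : ℝ, 0 < δ ∧ ∀ s u v : ℝ,
      (Fin.snoc (Fin.snoc (Fin.snoc (Fin.snoc W δ : Fin (n + 3) → ℝ) s : Fin (n + 4) → ℝ) u : Fin (n + 5) → ℝ) v :
        Fin (n + 6) → ℝ) ∈ M} := by
    have h := sa_exists_snoc (n := n + 2) h3'
    convert h using 1; ext W; simp
  have h2' : IsSemialgebraic ℝ {W : Fin (n + 2) → ℝ | 0 < W (Fin.last (n + 1)) → ∃ δ : ℝ, 0 < δ ∧ ∀ s u v : ℝ,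
      (Fin.snoc (Fin.snoc (Fin.snoc (Fin.snoc W δ : Fin (n + 3) → ℝ) s : Fin (n + 4) → ℝ) u : Fin (n + 5) → ℝ) v :
        Fin (n + 6) → ℝ) ∈ M} :=
    sa_imp (sa_const_lt _ _) h2
  have h1 : IsSemialgebraic ℝ {w : Fin (n + 1) → ℝ | ∀ ε : ℝ, 0 < ε → ∃ δ : ℝ, 0 < δ ∧ ∀ s u v : ℝ, pdW w ε δ s u v ∈ M} := by
    have h := sa_forall_snoc (n := n + 1) h2'
    convert h using 1; ext w; simp [pdW]
  -- the graph of the partial derivative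
  rw [isSemialgebraicFunOn_iff]
  have hMiff : ∀ (w : Fin (n + 1) → ℝ) (ε δ s u v : ℝ), pdW w ε δ s u v ∈ M ↔
      ((Function.update (Fin.init w) i s ∈ U ∧ u = f (Function.update (Fin.init w) i s)) →
        ((Fin.init w : Fin n → ℝ) ∈ U ∧ v = f (Fin.init w)) → ¬ s = w i.castSucc → (s - w i.castSucc) ^ 2 < δ ^ 2 →
        (u - v - w (Fin.last n) * (s - w i.castSucc)) ^ 2 < ε ^ 2 * (s - w i.castSucc) ^ 2) := by
    intro w ε δ s u v
    simp only [hM, mem_setOf_eq, pdW_comp_ixUpd, pdW_comp_ixZ, pdW_U, pdW_V, pdW_S, pdW_D, pdW_E, pdW_Y, pdW_Z]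
  have hkey : {w : Fin (n + 1) → ℝ | Fin.init w ∈ U ∧ w (Fin.last n) = partialDeriv f i (Fin.init w)} =
      {w | (Fin.init w : Fin n → ℝ) ∈ U} ∩ {w | ∀ ε : ℝ, 0 < ε → ∃ δ : ℝ, 0 < δ ∧ ∀ s u v : ℝ, pdW w ε δ s u v ∈ M} := by
    ext w
    simp only [mem_setOf_eq, mem_inter_iff]
    have hwi : Fin.init w i = w i.castSucc := rfl
    refine ⟨fun ⟨hz, hy⟩ => ⟨hz, ?_⟩, fun ⟨hz, H⟩ => ⟨hz, ?_⟩⟩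
    · intro ε hε
      obtain ⟨δ, hδ, h⟩ := (partialDeriv_eq_iff hU hd hz i _).1 hy ε hε
      refine ⟨δ, hδ, fun s u v => (hMiff w ε δ s u v).2 ?_⟩
      rintro ⟨hs, rfl⟩ ⟨-, rfl⟩ hne hsδ
      have h' := h s hs (by rw [hwi]; exact hne) (by rw [hwi]; exact hsδ)
      rw [hwi] at h'
      exact h'
    · refine (partialDeriv_eq_iff hU hd hz i _).2 fun ε hε => ?_
      obtain ⟨δ, hδ, h⟩ := H ε hε
      refine ⟨δ, hδ, fun s hs hne hsδ => ?_⟩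
      have h' := (hMiff w ε δ s _ _).1 (h s (f (Function.update (Fin.init w) i s)) (f (Fin.init w)))
        ⟨hs, rfl⟩ ⟨hz, rfl⟩ (by rw [← hwi]; exact hne) (by rw [← hwi]; exact hsδ)
      rw [hwi]
      exact h'
  rw [hkey]
  exact hUs.setOf_init_mem.inter h1

end PartialDeriv

end Literature.ModelTheory.ExponentialFields
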